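import Summits.BirchSwinnertonDyer.Rank1Residual.Additive.TameBranchOfSemistableTwist
import Literature.NumberTheory.EllipticCurves.CuspFormTwist
import Literature.NumberTheory.EllipticCurves.RootNumberTwistProofs
import Literature.NumberTheory.EllipticCurves.ModularSymbolsProofs
import Literature.NumberTheory.EllipticCurves.ModularFormsGamma0Genus
import HarnessLib

/-!
# Class N10, defect 2: the LEGENDRE TWIST RELATION of plus symbols PROVED (even branch) — the
# comparison statement `LegendreTwistPlusRel` of the Λ-level twist transport is a theorem for a
# pair of rational newforms `f = g ⊗ (·/p)` in `q`-expansion, `p ≡ 1 (mod 4)`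
# (cell `b2b-bsdres`, lane CLASS-CLOSURE, seat cc-typer-2 GEN 3; discharges the binder of
# `TameBranchOfSemistableTwist.lean` §4–§5 on its natural locus)

HONEST FRAMING (cell `b2b-bsdres`, run/shared/lean/b2b/bsd-rank1-residual/, verbatim in every
file): the goal of the cell is to DELETE the COMBINATION-SHAPED residual classes of the
Birch–Swinnerton-Dyer formula for ALL analytic-rank `≤ 1` elliptic curves over `ℚ` — "full BSD
formula for every rank `≤ 1` curve in class `C`" assembled STRICTLY from published theorems — so
that the rank-`≤ 1` remainder becomes exactly the CONSTRUCTION-SHAPED classes, which are TYPED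
(missing-input `Prop`s), NOT attempted. This is not "finishing BSD". Lane CLASS-CLOSURE
(coordinator ruling 2026-08-21T04:07Z): research routes, no claim beyond the stated classes;
census output = EVIDENCE / conjecture items with held-out validation, NEVER a Literature fact;
the class N10 stays CONSTRUCTION-shaped (RESIDUAL-MAP §I); NOTHING is booked. THEOREMS ONLY; no
definition, no named fact, no conjecture node; labels / RESIDUAL-MAP marks UNCHANGED.

## What and why

`TameBranchOfSemistableTwist.lean` delivers the E-normalised tame branch of an additive curve of
defect `2` from the Mazur–Tate–Teitelbaum measure of its twist MODULO the typed comparison statement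
`LegendreTwistPlusRel p f g c : ∀ s, [s]⁺_f = c·∑_{u mod p}(u/p)[s + u/p]⁺_g`. THIS FILE PROVES that
statement (∃ `c ∈ ℚ`) for every pair of normalised rational newforms `f ∈ S₂(Γ₀(N))`,
`g ∈ S₂(Γ₀(N'))` with `aₙ(f) = (n/p)·aₙ(g)` for all `n` (`q`-expansion twist) and `(−1/p) = 1`
(`p ≡ 1 (mod 4)`: EVEN branch, plus symbols on both sides), from the tree alone:
1. (`modularSymbol_charTwist`) the modular symbol of the tree's twist
   `charTwist L g = τ(χ̄)⁻¹ ∑_u χ̄(u) g(· + u/p)` (Shimura 1971 Prop. 3.64, `coe_charTwist`) is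
   `τ(χ̄)⁻¹ ∑_u χ̄(u) {∞, r + u/p}_g` — integrate `2π∫₀^∞ · (r + it) dt` term by term
   (`integrableOn_modularSymbol_integrand_holds`);
2. (`modularSymbol_eq_of_forall_cuspCoeff_eq`) two cusp forms (any levels) with the same
   `q`-expansion agree on `ℍ` (`hasSum_apply_ofComplex`), hence have the same modular symbols — so
   `{∞, r}_f = {∞, r}_{charTwist L g}` by `cuspCoeff_charTwist`;
3. (`plusSymbol_eq_sum_of_cuspCoeff_eq`) reflecting `u ↦ −u` with `1`-periodicity
   (`modularSymbol_add_intCast_holds`) and `χ(−1) = 1`: `plusSymbol f r = τ⁻¹ ∑_u χ(u) plusSymbol g (r + u/p)`;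
4. (`exists_legendreTwistPlusRel_of_cuspCoeff_eq`) normalise: `plusSymbol = Ω⁺·[·]⁺` on both sides
   (`plusSymbol_eq_re_holds`, `ratCast_ratPlusSymbol_holds`, `IsNewform0.plusPeriod_pos_holds`), so
   `[r]⁺_f = c₀·∑_u (u/p)[r + u/p]⁺_g` in `ℂ` with `c₀ = Ω⁺_g/(τ(χ̄)Ω⁺_f)`; if some twisted sum is
   non-zero, `c₀` is a quotient of two rationals, otherwise `c = 0` works — descent to `ℚ` WITHOUT any
   period theorem (Pal 2012 is not needed for the EXISTENCE of a rational `c`).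
CONSEQUENCE (companion file `LegendreTwistRelationOfCurveTwist.lean`, with the tree's
`cuspCoeff_eq_legendreSym_mul_cuspCoeff`): for `E` additive at `p ≡ 1 (mod 4)` with newform `f` and
`g` the newform of `E♭ = E^{(p)}`, `∃ c, LegendreTwistPlusRel p f g c`; whence, by
`TameBranchOfSemistableTwist.lean`, the tame branch `IsTameBranchOf f p (ι∘χ_p) α B` EXISTS on
(G-ord, `e = 2`) ∩ {`p ≡ 1 (4)`} (`α = unitRoot E♭ p`) and on (M) ∩ {`p ≡ 1 (4)`} (`α = a_p(E♭)`)
— the premise of `TameBranchRatCharEqAt` is inhabited there UNCONDITIONALLY.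
The odd branch (`p ≡ 3 (mod 4)`, minus symbols of `g`) is the same computation with
`minusSymbol`; not done here. Nothing booked; marks unchanged.

References: Shimura 1971 Prop. 3.64 [Shimura1971]; Mazur–Tate–Teitelbaum, Invent. Math. 84 (1986)
§I.8 [MazurTateTeitelbaum1986Invent]; Manin 1972 §1.2–1.6 [Manin1972]; Cremona 1997 §2.8
[CremonaAlgorithms1997].
-/

noncomputable section

open scoped Classical MatrixGroups ModularForm Real

open CongruenceSubgroup MeasureTheory Set UpperHalfPlane

namespace Summit.BirchSwinnertonDyer.Rank1Residual.Additive

open Literature.NumberTheory.EllipticCurves Literature.NumberTheory.EllipticCurves.ModularForms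
  Literature.NumberTheory.EllipticCurves.Rank1Residual WeierstrassCurve

/-! ### §1 Reflecting a twisted sum of a `1`-periodic function -/

section Reflect

variable {p : ℕ} [hp : Fact p.Prime]

/-- For a `1`-periodic `h : ℚ → M`: `h(s + (−u).val/p) = h(s − u.val/p)` (`(−u).val/p` and
`−u.val/p` differ by `0` or `1`). [folklore] -/
theorem apply_add_neg_val_div_eq {M : Type*} (h : ℚ → M) (hper : ∀ x, h (x + 1) = h x) (s : ℚ)
    (u : ZMod p) : h (s + ((-u).val : ℚ) / p) = h (s - (u.val : ℚ) / p) := by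
  haveI : NeZero p := ⟨hp.out.ne_zero⟩
  have hp0 : (p : ℚ) ≠ 0 := Nat.cast_ne_zero.mpr hp.out.ne_zero
  rw [ZMod.neg_val]
  split_ifs with hu
  · simp [hu]
  · have hle : u.val ≤ p := (ZMod.val_lt u).le
    rw [Nat.cast_sub hle, show s + ((p : ℚ) - (u.val : ℚ)) / p = (s - (u.val : ℚ) / p) + 1 by
      field_simp; ring, hper]

/-- **Reflection**: `∑_u ψ(u)·h(s + u/p) = ∑_u ψ(−u)·h(s − u/p)` for a `1`-periodic `h`. [folklore] -/
theorem sum_mul_apply_add_eq_sum_neg {R : Type*} [CommRing R] (ψ : ZMod p → R) (h : ℚ → R)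
    (hper : ∀ x, h (x + 1) = h x) (s : ℚ) :
    ∑ u : ZMod p, ψ u * h (s + (u.val : ℚ) / p) =
      ∑ u : ZMod p, ψ (-u) * h (s - (u.val : ℚ) / p) := by
  rw [← Equiv.sum_comp (Equiv.neg (ZMod p)) (fun u ↦ ψ u * h (s + (u.val : ℚ) / p))]
  refine Finset.sum_congr rfl fun u _ ↦ ?_
  simp only [Equiv.neg_apply]
  rw [apply_add_neg_val_div_eq h hper s u]

end Reflect

/-! ### §2 The modular symbol of the twist `charTwist L g` -/

section TwistSymbol

variable {N' : ℕ} [NeZero N'] {m : ℕ} [NeZero m] (L : ℕ) [NeZero L]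

omit [NeZero m] in
/-- Translating the base point: `(u/m) +ᵥ (r + it) = (r + u/m) + it` in `ℍ` (`t > 0`). [folklore] -/
theorem twistShift_vadd_ofComplex (u : ZMod m) (r : ℚ) {t : ℝ} (ht : 0 < t) :
    ((twistShift u : ℚ) : ℝ) +ᵥ ofComplex ((r : ℂ) + t * Complex.I) =
      ofComplex ((((r + twistShift u : ℚ)) : ℂ) + t * Complex.I) := by
  have h1 : 0 < ((r : ℂ) + t * Complex.I).im := by simpa using ht
  have h2 : 0 < ((((r + twistShift u : ℚ)) : ℂ) + t * Complex.I).im := by simpa using ht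
  apply UpperHalfPlane.ext
  rw [coe_vadd, ofComplex_apply_of_im_pos h1, ofComplex_apply_of_im_pos h2]
  push_cast
  ring

/-- **The twist evaluated on a vertical ray**: for `t > 0`,
`(charTwist L g)(r + it) = τ(χ⁻¹)⁻¹ · ∑_u χ⁻¹(u) · g((r + u/m) + it)` (`coe_charTwist`,
`coe_twistRaw`, `slash_twistT_apply`). [cite: Shimura1971, Prop. 3.64] -/
theorem charTwist_apply_ofComplex (hN : N' ∣ L) (hm : m ^ 2 ∣ L) {χ : DirichletCharacter ℂ m}
    (hχ : χ.IsQuadratic) (g : CuspForm (Gamma0 N') 2) (r : ℚ) {t : ℝ} (ht : 0 < t) :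
    charTwist L hN hm hχ g (ofComplex ((r : ℂ) + t * Complex.I)) =
      (gaussSum χ⁻¹ (ZMod.stdAddChar (N := m)))⁻¹ *
        ∑ u : ZMod m, χ⁻¹ u * g (ofComplex ((((r + twistShift u : ℚ)) : ℂ) + t * Complex.I)) := by
  have h := congrFun (coe_charTwist L hN hm hχ g) (ofComplex ((r : ℂ) + t * Complex.I))
  rw [h, Pi.smul_apply, smul_eq_mul, congrFun (coe_twistRaw L hN hm g χ) _, Finset.sum_apply]
  congr 1
  refine Finset.sum_congr rfl fun u _ ↦ ?_
  rw [Pi.smul_apply, smul_eq_mul, slash_twistT_apply, twistShift_vadd_ofComplex u r ht]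

/-- **The modular symbol of the twist**: `{∞, r}_{charTwist L g} = τ(χ⁻¹)⁻¹ ∑_{u mod m} χ⁻¹(u) {∞, r + u/m}_g`
— the function-level twisting identity of Shimura 1971 Prop. 3.64 (`coe_charTwist`) integrated along
the vertical ray `2π∫₀^∞ · (r + it) dt`, each translate being integrable
(`integrableOn_modularSymbol_integrand_holds`). (Mazur–Tate–Teitelbaum 1986 §I.8: twisted modular
symbols.) [cite: Shimura1971, Prop. 3.64] [cite: MazurTateTeitelbaum1986Invent, §I.8] -/
theorem modularSymbol_charTwist (hN : N' ∣ L) (hm : m ^ 2 ∣ L) {χ : DirichletCharacter ℂ m}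
    (hχ : χ.IsQuadratic) (g : CuspForm (Gamma0 N') 2) (r : ℚ) :
    modularSymbol (charTwist L hN hm hχ g) r =
      (gaussSum χ⁻¹ (ZMod.stdAddChar (N := m)))⁻¹ *
        ∑ u : ZMod m, χ⁻¹ u * modularSymbol g (r + twistShift u) := by
  set τ := (gaussSum χ⁻¹ (ZMod.stdAddChar (N := m)))⁻¹ with hτ
  have hint : ∀ u : ZMod m, IntegrableOn
      (fun t : ℝ ↦ g (ofComplex ((((r + twistShift u : ℚ)) : ℂ) + t * Complex.I))) (Ioi 0) :=
    fun u ↦ integrableOn_modularSymbol_integrand_holds g (r + twistShift u)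
  have hI : ∀ t ∈ Ioi (0 : ℝ), charTwist L hN hm hχ g (ofComplex ((r : ℂ) + t * Complex.I)) =
      τ * ∑ u : ZMod m, χ⁻¹ u * g (ofComplex ((((r + twistShift u : ℚ)) : ℂ) + t * Complex.I)) :=
    fun t ht ↦ charTwist_apply_ofComplex L hN hm hχ g r ht
  rw [modularSymbol, setIntegral_congr_fun measurableSet_Ioi hI, integral_const_mul,
    integral_finsetSum _ (fun u _ ↦ (hint u).const_mul (χ⁻¹ u))]
  simp_rw [integral_const_mul]
  simp only [modularSymbol, Finset.mul_sum]
  refine Finset.sum_congr rfl fun u _ ↦ ?_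
  ring

end TwistSymbol

/-! ### §3 Same `q`-expansion, same modular symbols -/

section QExpansion

variable {N N' : ℕ} [NeZero N] [NeZero N']

/-- Two weight-`2` cusp forms (possibly of different levels) with the same `q`-expansion take the
same values on the upper half-plane (`hasSum_apply_ofComplex`, uniqueness of sums). [folklore] -/
theorem apply_ofComplex_eq_of_forall_cuspCoeff_eq (f : CuspForm (Gamma0 N) 2)
    (F : CuspForm (Gamma0 N') 2) (h : ∀ n, cuspCoeff f n = cuspCoeff F n) (x : ℝ) {t : ℝ}
    (ht : 0 < t) : f (ofComplex ((x : ℂ) + t * Complex.I)) = F (ofComplex ((x : ℂ) + t * Complex.I)) := by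
  have hf := hasSum_apply_ofComplex f x ht
  have hF := hasSum_apply_ofComplex F x ht
  simp_rw [h] at hf
  exact hf.unique hF

/-- **Same `q`-expansion ⟹ same modular symbols** (any two levels). [folklore] -/
theorem modularSymbol_eq_of_forall_cuspCoeff_eq (f : CuspForm (Gamma0 N) 2)
    (F : CuspForm (Gamma0 N') 2) (h : ∀ n, cuspCoeff f n = cuspCoeff F n) (r : ℚ) :
    modularSymbol f r = modularSymbol F r := by
  have hI : ∀ t ∈ Ioi (0 : ℝ), f (ofComplex ((r : ℂ) + t * Complex.I)) =
      F (ofComplex ((r : ℂ) + t * Complex.I)) := fun t ht ↦ by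
    have key := apply_ofComplex_eq_of_forall_cuspCoeff_eq f F h (r : ℝ) ht
    rwa [Complex.ofReal_ratCast] at key
  rw [modularSymbol, modularSymbol, setIntegral_congr_fun measurableSet_Ioi hI]

end QExpansion

/-! ### §4 The plus symbols of a `(·/p)`-twist, `p ≡ 1 (mod 4)` -/

section Plus

variable {p : ℕ} [hp : Fact p.Prime] {N N' : ℕ} [NeZero N] [NeZero N']

/-- **Modular symbols of a `q`-expansion twist**: if `aₙ(f) = (n/p)·aₙ(g)` for all `n` (`p` odd),
then `{∞, r}_f = τ⁻¹ ∑_{u mod p} (u/p) {∞, r + u/p}_g` with `τ = τ((·/p))` the quadratic Gauss sum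
(of `(·/p) ⊗ ℂ = (quadraticChar 𝔽_p).ringHomComp ℤ→ℂ` against `stdAddChar`): `f` has the
`q`-expansion of `charTwist (N'p²) g` (`cuspCoeff_charTwist`), so the two agree on `ℍ` (§3), and §2
computes the symbol of the twist. [cite: Shimura1971, Prop. 3.64] -/
theorem modularSymbol_eq_sum_of_cuspCoeff_eq (hp2 : p ≠ 2) {f : CuspForm (Gamma0 N) 2}
    {g : CuspForm (Gamma0 N') 2} (h : ∀ n, cuspCoeff f n = (legendreSym p n : ℂ) * cuspCoeff g n)
    (r : ℚ) :
    modularSymbol f r =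
      (gaussSum ((quadraticChar (ZMod p)).ringHomComp (Int.castRingHom ℂ))
          (ZMod.stdAddChar (N := p)))⁻¹ *
        ∑ u : ZMod p, (legendreSym p (u.val : ℤ) : ℂ) * modularSymbol g (r + (u.val : ℚ) / p) := by
  haveI : NeZero p := ⟨hp.out.ne_zero⟩
  haveI : NeZero (N' * p ^ 2) := ⟨mul_ne_zero (NeZero.ne N') (pow_ne_zero _ hp.out.ne_zero)⟩
  set χ := (quadraticChar (ZMod p)).ringHomComp (Int.castRingHom ℂ) with hχdef
  have hχq : χ.IsQuadratic := isQuadratic_quadraticChar_ringHomComp p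
  have hprim : DirichletCharacter.IsPrimitive χ := isPrimitive_quadraticChar_ringHomComp p hp2
  have hχinv : χ⁻¹ = χ := hχq.inv
  have hχu : ∀ u : ZMod p, χ u = (legendreSym p (u.val : ℤ) : ℂ) := fun u ↦ by
    rw [hχdef, ← quadraticChar_ringHomComp_apply p (u.val : ℤ), Int.cast_natCast,
      ZMod.natCast_zmod_val]
  have hχn : ∀ n : ℕ, χ n = (legendreSym p n : ℂ) := fun n ↦ by
    rw [hχdef, quadraticChar_ringHomComp_apply_natCast]
  have hcoe : ∀ n, cuspCoeff f n =
      cuspCoeff (charTwist (N' * p ^ 2) (dvd_mul_right N' (p ^ 2)) (dvd_mul_left (p ^ 2) N') hχq g)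
        n := fun n ↦ by
    rw [h n, cuspCoeff_charTwist _ _ _ hχq hprim g n, hχn]
  rw [modularSymbol_eq_of_forall_cuspCoeff_eq f _ hcoe r, modularSymbol_charTwist, hχinv]
  congr 1
  refine Finset.sum_congr rfl fun u _ ↦ ?_
  rw [hχu, twistShift]

omit [NeZero N] [NeZero N'] in
/-- `(−u/p) = (u/p)` for the representatives, when `(−1/p) = 1`. [folklore] -/
theorem legendreSym_neg_val_eq (heven : legendreSym p (-1) = 1) (u : ZMod p) :
    legendreSym p ((-u).val : ℤ) = legendreSym p (u.val : ℤ) := by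
  have h1 : (((-u).val : ℤ) : ZMod p) = (((-1 : ℤ) * (u.val : ℤ) : ℤ) : ZMod p) := by
    push_cast
    rw [ZMod.natCast_zmod_val, ZMod.natCast_zmod_val, neg_one_mul]
  rw [legendreSym.mod p ((-u).val : ℤ), show (((-u).val : ℤ) : ℤ) % (p : ℤ) =
    ((-1 : ℤ) * (u.val : ℤ)) % (p : ℤ) from (ZMod.intCast_eq_intCast_iff' _ _ _).mp h1,
    ← legendreSym.mod, legendreSym.mul, heven, one_mul]

/-- **Plus symbols of a `q`-expansion twist, EVEN branch** (`(−1/p) = 1`, i.e. `p ≡ 1 (mod 4)`):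
`plusSymbol f r = τ⁻¹ ∑_{u mod p} (u/p)·plusSymbol g (r + u/p)` — from the previous identity at `r`
and `−r`, reflecting `u ↦ −u` in the second (`sum_mul_apply_add_eq_sum_neg`, `1`-periodicity of
`{∞, ·}_g`, `(−u/p) = (−1/p)(u/p) = (u/p)`). [cite: MazurTateTeitelbaum1986Invent, §I.8] -/
theorem plusSymbol_eq_sum_of_cuspCoeff_eq (hp2 : p ≠ 2) (heven : legendreSym p (-1) = 1)
    {f : CuspForm (Gamma0 N) 2} {g : CuspForm (Gamma0 N') 2}
    (h : ∀ n, cuspCoeff f n = (legendreSym p n : ℂ) * cuspCoeff g n) (r : ℚ) :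
    plusSymbol f r =
      (gaussSum ((quadraticChar (ZMod p)).ringHomComp (Int.castRingHom ℂ))
          (ZMod.stdAddChar (N := p)))⁻¹ *
        ∑ u : ZMod p, (legendreSym p (u.val : ℤ) : ℂ) * plusSymbol g (r + (u.val : ℚ) / p) := by
  have hper : ∀ x : ℚ, modularSymbol g (x + 1) = modularSymbol g x := fun x ↦ by
    exact_mod_cast modularSymbol_add_intCast_holds g x 1
  have h1 := modularSymbol_eq_sum_of_cuspCoeff_eq hp2 h r
  have h2 := modularSymbol_eq_sum_of_cuspCoeff_eq hp2 h (-r)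
  rw [sum_mul_apply_add_eq_sum_neg (fun u : ZMod p ↦ (legendreSym p (u.val : ℤ) : ℂ))
    (modularSymbol g) hper (-r)] at h2
  simp only [legendreSym_neg_val_eq heven] at h2
  have hsum : ∑ u : ZMod p, (legendreSym p (u.val : ℤ) : ℂ) * plusSymbol g (r + (u.val : ℚ) / p) =
      (∑ u : ZMod p, (legendreSym p (u.val : ℤ) : ℂ) * modularSymbol g (r + (u.val : ℚ) / p) +
        ∑ u : ZMod p, (legendreSym p (u.val : ℤ) : ℂ) * modularSymbol g (-r - (u.val : ℚ) / p)) / 2 := by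
    rw [add_div, Finset.sum_div, Finset.sum_div, ← Finset.sum_add_distrib]
    refine Finset.sum_congr rfl fun u _ ↦ ?_
    rw [plusSymbol, show -(r + (u.val : ℚ) / p) = -r - (u.val : ℚ) / p by ring]
    ring
  rw [plusSymbol, h1, h2, hsum]
  ring

/-- **The Legendre twist relation of plus symbols, PROVED (even branch).** Let `f ∈ S₂(Γ₀(N))`,
`g ∈ S₂(Γ₀(N'))` be normalised newforms with rational coefficients such that `aₙ(f) = (n/p)·aₙ(g)`
for all `n`, `p` an odd prime with `(−1/p) = 1`. Then there is `c ∈ ℚ` with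
`[s]⁺_f = c · ∑_{u mod p} (u/p)·[s + u/p]⁺_g` for every `s ∈ ℚ` (`LegendreTwistPlusRel p f g c`).
Proof: §4 in `ℂ` with `plusSymbol = Ω⁺·[·]⁺` on both sides (`plusSymbol_eq_re_holds`,
`ratCast_ratPlusSymbol_holds`, `Ω⁺ > 0` by `IsNewform0.plusPeriod_pos_holds`) gives
`[s]⁺_f = c₀·∑(u/p)[s + u/p]⁺_g` with `c₀ = Ω⁺_g/(τ·Ω⁺_f) ∈ ℂ`; if some twisted sum is non-zero
then `c₀ ∈ ℚ` (a quotient of two rationals), else `c = 0` works. No period theorem is used.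
[cite: Shimura1971, Prop. 3.64] [cite: MazurTateTeitelbaum1986Invent, §I.8] -/
theorem exists_legendreTwistPlusRel_of_cuspCoeff_eq (hp2 : p ≠ 2) (heven : legendreSym p (-1) = 1)
    {f : CuspForm (Gamma0 N) 2} {g : CuspForm (Gamma0 N') 2} (hf : IsNewform0 f)
    (hfQ : coeffField f = ⊥) (hg : IsNewform0 g) (hgQ : coeffField g = ⊥)
    (h : ∀ n, cuspCoeff f n = (legendreSym p n : ℂ) * cuspCoeff g n) :
    ∃ c : ℚ, LegendreTwistPlusRel p f g c := by
  -- `plusSymbol = Ω⁺ · [·]⁺` on both sides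
  have hrealf : ∀ n, (cuspCoeff f n).im = 0 := cuspCoeff_im_eq_zero_of_coeffField_eq_bot hfQ
  have hrealg : ∀ n, (cuspCoeff g n).im = 0 := cuspCoeff_im_eq_zero_of_coeffField_eq_bot hgQ
  have hΩf : 0 < plusPeriod f := IsNewform0.plusPeriod_pos_holds hf hfQ
  have hΩg : 0 < plusPeriod g := IsNewform0.plusPeriod_pos_holds hg hgQ
  have hPf : ∀ r : ℚ, plusSymbol f r = ((plusPeriod f * (ratPlusSymbol f r : ℝ) : ℝ) : ℂ) := by
    intro r
    have h1 := plusSymbol_eq_re_holds f hrealf r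
    have h2 : (ratPlusSymbol f r : ℝ) = (plusSymbol f r).re / plusPeriod f :=
      ratCast_ratPlusSymbol_holds hf hfQ r
    have h3 : (plusSymbol f r).re = plusPeriod f * (ratPlusSymbol f r : ℝ) := by
      rw [h2]; field_simp
    rw [← h3, h1, Complex.ofReal_re]
  have hPg : ∀ r : ℚ, plusSymbol g r = ((plusPeriod g * (ratPlusSymbol g r : ℝ) : ℝ) : ℂ) := by
    intro r
    have h1 := plusSymbol_eq_re_holds g hrealg r
    have h2 : (ratPlusSymbol g r : ℝ) = (plusSymbol g r).re / plusPeriod g :=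
      ratCast_ratPlusSymbol_holds hg hgQ r
    have h3 : (plusSymbol g r).re = plusPeriod g * (ratPlusSymbol g r : ℝ) := by
      rw [h2]; field_simp
    rw [← h3, h1, Complex.ofReal_re]
  -- the identity in `ℂ`: `Ω_f [s]_f = τ⁻¹ Σ (u/p) Ω_g [s + u/p]_g`
  set τi : ℂ := (gaussSum ((quadraticChar (ZMod p)).ringHomComp (Int.castRingHom ℂ))
    (ZMod.stdAddChar (N := p)))⁻¹ with hτi
  set q₂ : ℚ → ℚ := fun s ↦
    ∑ u : ZMod p, (legendreSym p (u.val : ℤ) : ℚ) * ratPlusSymbol g (s + (u.val : ℚ) / p) with hq₂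
  have hC : ∀ s : ℚ, ((plusPeriod f : ℝ) : ℂ) * ((ratPlusSymbol f s : ℚ) : ℂ) =
      τi * ((plusPeriod g : ℝ) : ℂ) * ((q₂ s : ℚ) : ℂ) := by
    intro s
    have hs := plusSymbol_eq_sum_of_cuspCoeff_eq hp2 heven h s
    rw [hPf] at hs
    simp_rw [hPg] at hs
    rw [hq₂]
    push_cast at hs ⊢
    rw [hs, Finset.mul_sum, Finset.mul_sum]
    refine Finset.sum_congr rfl fun u _ ↦ ?_
    ring
  have hΩf0 : ((plusPeriod f : ℝ) : ℂ) ≠ 0 := by exact_mod_cast hΩf.ne'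
  by_cases hq : ∃ s₀, q₂ s₀ ≠ 0
  · obtain ⟨s₀, hs₀⟩ := hq
    refine ⟨ratPlusSymbol f s₀ / q₂ s₀, fun s ↦ ?_⟩
    -- `c₀ = [s₀]_f / q₂ s₀`, then compare at `s`
    have hq0 : ((q₂ s₀ : ℚ) : ℂ) ≠ 0 := by exact_mod_cast hs₀
    have hc0 : τi * ((plusPeriod g : ℝ) : ℂ) =
        ((plusPeriod f : ℝ) : ℂ) * ((ratPlusSymbol f s₀ : ℚ) : ℂ) / ((q₂ s₀ : ℚ) : ℂ) := by
      rw [eq_div_iff hq0, hC s₀]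
    have hs := hC s
    rw [hc0] at hs
    apply Rat.cast_injective (α := ℂ)
    have : ((ratPlusSymbol f s : ℚ) : ℂ) =
        ((ratPlusSymbol f s₀ : ℚ) : ℂ) / ((q₂ s₀ : ℚ) : ℂ) * ((q₂ s : ℚ) : ℂ) := by
      field_simp at hs ⊢
      linear_combination hs
    rw [this]
    push_cast [hq₂]
    ring
  · push Not at hq
    refine ⟨0, fun s ↦ ?_⟩
    have hs := hC s
    rw [hq s, Rat.cast_zero, mul_zero] at hs
    have h0 : ((ratPlusSymbol f s : ℚ) : ℂ) = 0 := by
      rcases mul_eq_zero.mp hs with h | h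
      · exact absurd h hΩf0
      · exact h
    have h0' : ratPlusSymbol f s = 0 := by exact_mod_cast h0
    rw [h0', zero_mul]

end Plus

end Summit.BirchSwinnertonDyer.Rank1Residual.Additive

end
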